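import Summits.Schanuel.Schanuel.Theorems.RootDecomp1KCommonRadixCell02

/-!
# RootDecomp1KCommonRadixCell — lens 1, generation 37 «COMMON-RADIX WALL CELL of 33364» (the dependent-base wall `(1, ℓ₂, ℓ₄)`) — continuation (RootDecomp1KCommonRadixCell03): §5 tools and the extraction engine (`TruncGeneric b ∧ MvPolyMeasure θ ⇒ AlgebraicIndependent ℚ (ℓ_b, θ)`)

(lens-1 g37 `RootDecomp1KCommonRadixCell.lean`, sha256 2ee3a3e8…2418, own farm rc 0 · 0 sorry · axioms std; critic VERDICT STATUS L1748
(credit K-R23 (β′), PORT GO LOW); port by census-1 gen 16 in seven parts `RootDecomp1KCommonRadixCell01`–`07` — see the PORT NOTE of part 01;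
`--supports stmt-Schanuel-33364`; rung 0.)
-/

noncomputable section

open Complex IntermediateField Polynomial
open Summit.Schanuel.Schanuel.Theorems.RootDecomp1KHyper
open Summit.Schanuel.Schanuel.Theorems.RootDecomp1KHyper.HyperCell
open Summit.Schanuel.Schanuel.Theorems.RootDecomp1KGeneric
open Summit.Schanuel.Schanuel.Theorems.RootDecomp1KRelLiouvilleCell
open Summit.Schanuel.Schanuel.Theorems.RootDecomp1KLogLogCell (LogLogLiouville logLogLiouville_of_logSqLiouville
  logLogLiouville_of_logHyperLiouville logLogLiouville_of_hyperLiouville)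
open Summit.Schanuel.Schanuel.Theorems.RootDecomp1KTwoBaseCell (partialSum_pos' liouvilleNumber_le partialSum_lt_two numerator_lt exists_int_mul_eq_map' algebraicIndependent_of_forall_int' norm_pow_sub_pow_le' norm_prod_pow_sub_prod_pow_le norm_aeval_sub_aeval_le growth_beats lpart
  tpart lpart_apply tpart_apply eq_of_parts_eq psNumer partialSum_eq_psNumer_div coprime_psNumer liouvilleNumber_sub_rat_lower_loglog not_logLogLiouville_liouvilleNumber liouvilleNumber_three_lt_one sb_of_range_eq')

namespace Summit.Schanuel.Schanuel.Theorems.RootDecomp1KCommonRadixCell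

open LiouvilleNumber
open scoped Nat

/-- Upper bound for the tail in base `m ≥ 2`: `r_k ≤ 2·m^{-(k+1)!}` (g36, verbatim). -/
private theorem remainder_le {m : ℝ} (hm : 2 ≤ m) (k : ℕ) : remainder m k ≤ 2 / m ^ (k + 1)! := by
  have m1 : (1 : ℝ) < m := by linarith
  have m0 : (0 : ℝ) < m := by linarith
  have h := remainder_lt' k m1
  have hhalf : (1 : ℝ) / m ≤ 1 / 2 := one_div_le_one_div_of_le two_pos hm
  have hpos : (0 : ℝ) < 1 - 1 / m := by linarith
  have hinv : (1 - 1 / m)⁻¹ ≤ 2 := by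
    rw [inv_le_comm₀ hpos two_pos]
    linarith
  have hmk : (0 : ℝ) < 1 / m ^ (k + 1)! := by positivity
  calc remainder m k ≤ (1 - 1 / m)⁻¹ * (1 / m ^ (k + 1)!) := h.le
    _ ≤ 2 * (1 / m ^ (k + 1)!) := mul_le_mul_of_nonneg_right hinv hmk.le
    _ = 2 / m ^ (k + 1)! := by ring

/-! ## §5  The extraction (g36 §4, generalised): `TruncGeneric b ∧ MvPolyMeasure θ ⇒ AlgebraicIndependent ℚ (ℓ_b, θ)`,
## and the equivalence `TruncGeneric b ⟺ AlgebraicIndependent ℚ ℓ_b` -/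

section Tools
/-! (g36 §4 Tools, verbatim) -/

variable {n : ℕ}

/-- `mvlen (c·X^m) ≤ |c|`. -/
private theorem mvlen_monomial_le' (m : Fin n →₀ ℕ) (c : ℤ) : mvlen (MvPolynomial.monomial m c) ≤ |c| := by
  classical
  rw [mvlen_eq_sum_of_support_subset _ MvPolynomial.support_monomial_subset, Finset.sum_singleton,
    MvPolynomial.coeff_monomial, if_pos rfl]

/-- Subadditivity of `mvlen`. -/
private theorem mvlen_add_le' (P Q : MvPolynomial (Fin n) ℤ) : mvlen (P + Q) ≤ mvlen P + mvlen Q := by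
  classical
  have hs : (P + Q).support ⊆ P.support ∪ Q.support := MvPolynomial.support_add
  rw [mvlen_eq_sum_of_support_subset _ hs,
    mvlen_eq_sum_of_support_subset P (Finset.subset_union_left (s₂ := Q.support)),
    mvlen_eq_sum_of_support_subset Q (Finset.subset_union_right (s₁ := P.support)),
    ← Finset.sum_add_distrib]
  exact Finset.sum_le_sum fun m _ => by rw [MvPolynomial.coeff_add]; exact abs_add_le _ _

/-- `mvlen (Σ F_i) ≤ Σ mvlen F_i`. -/
private theorem mvlen_sum_le' {ι : Type*} (s : Finset ι) (F : ι → MvPolynomial (Fin n) ℤ) :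
    mvlen (∑ i ∈ s, F i) ≤ ∑ i ∈ s, mvlen (F i) := by
  classical
  induction s using Finset.induction_on with
  | empty => simp [mvlen]
  | insert a s ha ih =>
    rw [Finset.sum_insert ha, Finset.sum_insert ha]
    exact (mvlen_add_le' _ _).trans (by linarith)

end Tools

section Engine
open LiouvilleNumber
open scoped Nat

variable {k n : ℕ}

/-- **TRUNCATION-GENERICITY** of a vector of bases `b` (the abstraction of g36's lacunary lemma (L) and of this
file's common-radix theorem (CR)): no non-zero INTEGER polynomial vanishes at the simultaneous truncations
`s_N = (partialSum b_i N)_i` for all large `N`.  By `truncGeneric_iff_algebraicIndependent` below it is EQUIVALENT to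
the algebraic independence of `(ℓ_{b_1}, …, ℓ_{b_k})` over `ℚ` (cf. Zhu Yaochen 2024, Thm 1.1.1). -/
def TruncGeneric (b : Fin k → ℕ) : Prop :=
  ∀ q : MvPolynomial (Fin k) ℤ, q ≠ 0 → ∀ N₀ : ℕ, ∃ N : ℕ, N₀ ≤ N ∧
    MvPolynomial.aeval (fun i => partialSum (b i : ℝ) N) q ≠ 0

/-- **THE ENGINE (X′).** Bases `b_i ≥ 2` forming a truncation-generic vector, and a tuple `θ` with a polynomial
measure of algebraic independence in every degree (`MvPolyMeasure θ`, tree): then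
`(ℓ_{b_1}, …, ℓ_{b_k}, θ_1, …, θ_n)` is algebraically independent over `ℚ`.  (Proof = g36 §4 verbatim — Liouville
approximation of `P(ℓ, θ)` by `P(s_N, θ)`, cleared to an integer polynomial `H` in `θ` of controlled length, fed to
the measure — except that the non-vanishing of the `θ`-coefficient `q(s_N)` now comes from `TruncGeneric`.) -/
theorem algebraicIndependent_liouville_of_truncGeneric {b : Fin k → ℕ} (hb : ∀ i, 2 ≤ b i)
    (hnv : TruncGeneric b) {θ : Fin n → ℂ} (hθ : MvPolyMeasure θ) :
    AlgebraicIndependent ℚ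
      (Sum.elim (fun i => ((liouvilleNumber (b i) : ℝ) : ℂ)) θ : Fin k ⊕ Fin n → ℂ) := by
  classical
  refine algebraicIndependent_of_forall_int' fun P hP0 hPval => ?_
  -- bases
  have hbpos : ∀ i, 0 < b i := fun i => by have := hb i; omega
  have hb1 : ∀ i, (1 : ℝ) < b i := fun i => by exact_mod_cast (by have := hb i; omega : 1 < b i)
  have hb2 : ∀ i, (2 : ℝ) ≤ b i := fun i => by exact_mod_cast hb i
  set ℓ : Fin k → ℝ := fun i => liouvilleNumber (b i) with hℓ
  -- degree and measure
  set d : ℕ := P.totalDegree with hd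
  obtain ⟨C, τ, hC, hmeas⟩ := hθ d
  have hdeg : ∀ e ∈ P.support, ∑ x, e x ≤ d := fun e he => by
    have h1 := MvPolynomial.le_totalDegree he
    rwa [Finsupp.sum_fintype _ _ (fun _ => rfl)] at h1
  have hdegl : ∀ e ∈ P.support, ∀ i, e (Sum.inl i) ≤ d := fun e he i => by
    refine le_trans ?_ (hdeg e he)
    exact Finset.single_le_sum (f := fun x => e x) (fun _ _ => Nat.zero_le _) (Finset.mem_univ _)
  have hdegL : ∀ e ∈ P.support, ∑ i, e (Sum.inl i) ≤ d := fun e he => by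
    refine le_trans ?_ (hdeg e he)
    rw [Fintype.sum_sum_type]; exact Nat.le_add_right _ _
  have hdegT : ∀ e ∈ P.support, ∑ j, e (Sum.inr j) ≤ d := fun e he => by
    refine le_trans ?_ (hdeg e he)
    rw [Fintype.sum_sum_type]; exact Nat.le_add_left _ _
  -- (a) the coefficient polynomial `q = Q_{α₀} ∈ ℝ[Y]` of one `θ`-monomial `α₀` and its non-vanishing
  obtain ⟨e₀, he₀⟩ := MvPolynomial.support_nonempty.mpr hP0
  set α₀ : Fin n →₀ ℕ := tpart e₀ with hα₀
  set S₀ : Finset (Fin k ⊕ Fin n →₀ ℕ) := P.support.filter (fun e => tpart e = α₀) with hS₀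
  have he₀S₀ : e₀ ∈ S₀ := Finset.mem_filter.mpr ⟨he₀, rfl⟩
  set q : MvPolynomial (Fin k) ℝ :=
    ∑ e ∈ S₀, MvPolynomial.monomial (lpart e) ((P.coeff e : ℤ) : ℝ) with hq
  have hq0 : q ≠ 0 := by
    intro h
    have hc : q.coeff (lpart e₀) = ((P.coeff e₀ : ℤ) : ℝ) := by
      rw [hq, MvPolynomial.coeff_sum, Finset.sum_eq_single e₀]
      · rw [MvPolynomial.coeff_monomial, if_pos rfl]
      · intro e he hne
        rw [MvPolynomial.coeff_monomial, if_neg]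
        intro hl
        exact hne (eq_of_parts_eq hl ((Finset.mem_filter.mp he).2.trans rfl))
      · intro h0; exact absurd he₀S₀ h0
    rw [h, MvPolynomial.coeff_zero] at hc
    exact (MvPolynomial.mem_support_iff.mp he₀) (by exact_mod_cast hc.symm)
  -- (a') its integer model `qZ` (`map ℤ→ℝ qZ = q`), to which `TruncGeneric` applies
  set qZ : MvPolynomial (Fin k) ℤ := ∑ e ∈ S₀, MvPolynomial.monomial (lpart e) (P.coeff e) with hqZ
  have hqmap : MvPolynomial.map (Int.castRingHom ℝ) qZ = q := by
    rw [hqZ, hq, map_sum]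
    refine Finset.sum_congr rfl fun e _ => ?_
    rw [MvPolynomial.map_monomial, eq_intCast]
  have hqZ0 : qZ ≠ 0 := by
    intro h; apply hq0; rw [← hqmap, h, map_zero]
  -- (b) constants
  set L : ℝ := ∑ e ∈ P.support, |((P.coeff e : ℤ) : ℝ)| with hL
  have hL0 : 0 ≤ L := Finset.sum_nonneg fun _ _ => abs_nonneg _
  set R : ℝ := 2 + ∑ j, ‖θ j‖ with hR
  have hθsum : 0 ≤ ∑ j, ‖θ j‖ := Finset.sum_nonneg fun _ _ => norm_nonneg _
  have hR1 : 1 ≤ R := by linarith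
  have hR2 : 2 ≤ R := by linarith
  have hθR : ∀ j, ‖θ j‖ ≤ R := fun j => by
    have : ‖θ j‖ ≤ ∑ j, ‖θ j‖ :=
      Finset.single_le_sum (f := fun j => ‖θ j‖) (fun _ _ => norm_nonneg _) (Finset.mem_univ j)
    linarith
  set W : ℕ := ∏ i, b i with hW
  have hWpos : 0 < W := Finset.prod_pos fun i _ => hbpos i
  set G : ℕ := W ^ (d * (τ + 1)) with hG
  have hGpos : 0 < G := pow_pos hWpos _
  set A₀ : ℝ := C * (2 ^ d * L) ^ τ * (L * (d * R ^ d * 2)) with hA₀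
  -- (c) the scale `N`: SUPPLIED BY TRUNCATION-GENERICITY (beyond the two growth thresholds)
  obtain ⟨N, hNN₁, hqN⟩ := hnv qZ hqZ0 (max G ⌈A₀⌉₊)
  have hNG : G ≤ 2 ^ N := le_trans (le_trans (le_max_left _ _) hNN₁) Nat.lt_two_pow_self.le
  have hNA : A₀ < 2 ^ N := by
    have h1 : A₀ ≤ ⌈A₀⌉₊ := Nat.le_ceil _
    have h2 : (⌈A₀⌉₊ : ℝ) ≤ (N : ℝ) := by exact_mod_cast le_trans (le_max_right _ _) hNN₁
    have h3 : ((N : ℕ) : ℝ) < 2 ^ N := by exact_mod_cast Nat.lt_two_pow_self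
    linarith
  -- (d) the truncations `s_i = p_i / b_i^{N!}` and the tails
  have hps : ∀ i, ∃ p : ℕ, partialSum (b i : ℝ) N = p / ((b i ^ N ! : ℕ) : ℝ) :=
    fun i => partialSum_eq_rat (hbpos i) N
  choose p hp using hps
  set s : Fin k → ℝ := fun i => partialSum (b i : ℝ) N with hs
  set Bq : Fin k → ℕ := fun i => b i ^ N ! with hBq
  have hBqpos : ∀ i, 0 < Bq i := fun i => pow_pos (hbpos i) _
  have hBqR : ∀ i, (0 : ℝ) < Bq i := fun i => by exact_mod_cast hBqpos i
  have hsp : ∀ i, s i = p i / Bq i := fun i => by rw [hs, hBq]; exact hp i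
  have hp_lt : ∀ i, p i < 2 * Bq i := fun i => numerator_lt (hb i) (hp i)
  have hp_le : ∀ i, (p i : ℝ) ≤ 2 * Bq i := fun i => by exact_mod_cast (hp_lt i).le
  have hs_pos : ∀ i, 0 < s i := fun i => partialSum_pos' (by linarith [hb1 i]) N
  have hs_lt : ∀ i, s i < 2 := fun i => partialSum_lt_two (hb2 i) N
  have hℓs : ∀ i, ℓ i - s i = remainder (b i) N := fun i => by
    have := partialSum_add_remainder (hb1 i) N; simp only [hℓ, hs]; linarith
  have hℓ_pos : ∀ i, 0 < ℓ i := fun i => by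
    have := hℓs i; linarith [remainder_pos (hb1 i) N, hs_pos i]
  have hℓ_lt : ∀ i, ℓ i < 2 := fun i => by
    have := liouvilleNumber_le (hb2 i); simp only [hℓ]; linarith
  set δ : ℝ := 2 / (2 : ℝ) ^ (N + 1)! with hδ
  have hδ0 : 0 ≤ δ := by positivity
  have hdiff : ∀ i, |s i - ℓ i| ≤ δ := fun i => by
    rw [abs_sub_comm, hℓs i, abs_of_pos (remainder_pos (hb1 i) N)]
    refine (remainder_le (hb2 i) N).trans ?_
    rw [hδ]
    exact div_le_div_of_nonneg_left (by norm_num) (by positivity)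
      (pow_le_pow_left₀ (by norm_num) (hb2 i) _)
  -- (e) the integer polynomial `H = D · P(s, X)` in the `θ`-variables
  set c : (Fin k ⊕ Fin n →₀ ℕ) → ℤ := fun e =>
    P.coeff e * ∏ i, ((p i : ℤ) ^ e (Sum.inl i) * (Bq i : ℤ) ^ (d - e (Sum.inl i))) with hc
  set H : MvPolynomial (Fin n) ℤ := ∑ e ∈ P.support, MvPolynomial.monomial (tpart e) (c e) with hH
  set D : ℝ := ∏ i, (Bq i : ℝ) ^ d with hD
  have hD0 : 0 < D := Finset.prod_pos fun i _ => pow_pos (hBqR i) _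
  -- (e1) the coefficients of `H`, as reals
  have hc_cast : ∀ e ∈ P.support,
      ((c e : ℤ) : ℝ) = ((P.coeff e : ℤ) : ℝ) * D * ∏ i, s i ^ e (Sum.inl i) := by
    intro e he
    rw [hc]; push_cast
    rw [hD, mul_assoc, ← Finset.prod_mul_distrib]
    congr 1
    refine Finset.prod_congr rfl fun i _ => ?_
    obtain ⟨t, ht⟩ := Nat.exists_eq_add_of_le (hdegl e he i)
    have hB : (Bq i : ℝ) ^ e (Sum.inl i) ≠ 0 := pow_ne_zero _ (hBqR i).ne'
    rw [hsp i, ht, Nat.add_sub_cancel_left, pow_add, div_pow, mul_div_assoc', eq_div_iff hB]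
    ring
  have hc_abs : ∀ e ∈ P.support, |((c e : ℤ) : ℝ)| ≤ |((P.coeff e : ℤ) : ℝ)| * (2 ^ d * D) := by
    intro e he
    rw [hc]; push_cast
    rw [abs_mul, Finset.abs_prod]
    refine mul_le_mul_of_nonneg_left ?_ (abs_nonneg _)
    have hterm : ∀ i, |(p i : ℝ) ^ e (Sum.inl i) * (Bq i : ℝ) ^ (d - e (Sum.inl i))| ≤
        2 ^ e (Sum.inl i) * (Bq i : ℝ) ^ d := by
      intro i
      rw [abs_of_nonneg (by positivity)]
      obtain ⟨t, ht⟩ := Nat.exists_eq_add_of_le (hdegl e he i)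
      rw [ht, Nat.add_sub_cancel_left, pow_add, ← mul_assoc]
      refine mul_le_mul_of_nonneg_right ?_ (by positivity)
      rw [← mul_pow]
      exact pow_le_pow_left₀ (by positivity) (hp_le i) _
    calc ∏ i, |(p i : ℝ) ^ e (Sum.inl i) * (Bq i : ℝ) ^ (d - e (Sum.inl i))|
        ≤ ∏ i, 2 ^ e (Sum.inl i) * (Bq i : ℝ) ^ d :=
          Finset.prod_le_prod (fun i _ => abs_nonneg _) fun i _ => hterm i
      _ = 2 ^ (∑ i, e (Sum.inl i)) * D := by
          rw [Finset.prod_mul_distrib, Finset.prod_pow_eq_pow_sum, hD]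
      _ ≤ 2 ^ d * D := by
          refine mul_le_mul_of_nonneg_right ?_ hD0.le
          exact pow_le_pow_right₀ (by norm_num) (hdegL e he)
  -- (e2) the value: `H(θ) = D · P(s, θ)`
  set xs : Fin k ⊕ Fin n → ℂ := Sum.elim (fun i => ((s i : ℝ) : ℂ)) θ with hxs
  set xl : Fin k ⊕ Fin n → ℂ := Sum.elim (fun i => ((ℓ i : ℝ) : ℂ)) θ with hxl
  have hHval : MvPolynomial.aeval θ H = (D : ℂ) * MvPolynomial.aeval xs P := by
    rw [hH, map_sum, MvPolynomial.aeval_def xs, MvPolynomial.eval₂_eq', Finset.mul_sum]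
    refine Finset.sum_congr rfl fun e he => ?_
    rw [MvPolynomial.aeval_monomial, Finsupp.prod_fintype _ _ (fun _ => pow_zero _),
      Fintype.prod_sum_type]
    simp only [tpart_apply, hxs, Sum.elim_inl, Sum.elim_inr, algebraMap_int_eq, eq_intCast]
    have h1 : ((c e : ℤ) : ℂ) = (((c e : ℤ) : ℝ) : ℂ) := by push_cast; rfl
    rw [h1, hc_cast e he]
    push_cast
    ring
  -- (e3) `H ≠ 0`: its `α₀`-coefficient is `D · q(s) ≠ 0`
  have hH0 : H ≠ 0 := by
    intro h0
    have hcoef : H.coeff α₀ = ∑ e ∈ S₀, c e := by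
      rw [hH, MvPolynomial.coeff_sum, hS₀, Finset.sum_filter]
      refine Finset.sum_congr rfl fun e _ => ?_
      rw [MvPolynomial.coeff_monomial]
    have hsum : (((∑ e ∈ S₀, c e : ℤ)) : ℝ) = D * MvPolynomial.eval s q := by
      rw [hq, map_sum]
      push_cast
      rw [Finset.mul_sum]
      refine Finset.sum_congr rfl fun e he => ?_
      have heS : e ∈ P.support := (Finset.mem_filter.mp he).1
      rw [MvPolynomial.eval_monomial, Finsupp.prod_fintype _ _ (fun _ => pow_zero _)]
      simp only [lpart_apply]
      rw [hc_cast e heS]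
      ring
    have hq_ne : MvPolynomial.eval s q ≠ 0 := by
      intro h0
      apply hqN
      rw [MvPolynomial.aeval_def, algebraMap_int_eq, ← MvPolynomial.eval_map, hqmap]
      exact h0
    have : (((∑ e ∈ S₀, c e : ℤ)) : ℝ) = 0 := by
      rw [← hcoef, h0, MvPolynomial.coeff_zero]; push_cast; rfl
    rw [hsum] at this
    rcases mul_eq_zero.mp this with hD' | hq'
    · exact absurd hD' hD0.ne'
    · exact hq_ne hq'
  -- (e4) degree and length of `H`
  have hHdeg : H.totalDegree ≤ d := by
    rw [hH]
    refine MvPolynomial.totalDegree_finsetSum_le fun e he => ?_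
    refine (MvPolynomial.totalDegree_monomial_le _ _).trans ?_
    rw [Finsupp.sum_fintype _ _ (fun _ => rfl)]
    simp only [tpart_apply, id]
    exact hdegT e he
  have hHlen : (mvlen H : ℝ) ≤ 2 ^ d * D * L := by
    have h1 : mvlen H ≤ ∑ e ∈ P.support, |c e| := by
      rw [hH]
      refine (mvlen_sum_le' _ _).trans (Finset.sum_le_sum fun e _ => mvlen_monomial_le' _ _)
    have h2 : (mvlen H : ℝ) ≤ ∑ e ∈ P.support, |((c e : ℤ) : ℝ)| := by
      have := (Int.cast_le (R := ℝ)).mpr h1; push_cast at this; exact this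
    refine h2.trans ?_
    rw [hL, Finset.mul_sum]
    refine Finset.sum_le_sum fun e he => ?_
    calc |((c e : ℤ) : ℝ)| ≤ |((P.coeff e : ℤ) : ℝ)| * (2 ^ d * D) := hc_abs e he
      _ = 2 ^ d * D * |((P.coeff e : ℤ) : ℝ)| := by ring
  have hHlen0 : (0 : ℝ) ≤ mvlen H := by exact_mod_cast mvlen_nonneg H
  -- (f) the measure at `H`
  have hM := hmeas H hH0 hHdeg
  rw [hHval, norm_mul, Complex.norm_real, Real.norm_eq_abs, abs_of_pos hD0] at hM
  -- (g) the Lipschitz upper bound: `‖P(s, θ)‖ = ‖P(s, θ) − P(ℓ, θ)‖ ≤ L d R^d δ`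
  have hval0 : MvPolynomial.aeval xl P = 0 := hPval
  have hx : ∀ x, ‖xs x‖ ≤ R := by
    intro x; cases x with
    | inl i => simp only [hxs, Sum.elim_inl, Complex.norm_real, Real.norm_eq_abs]
               rw [abs_of_pos (hs_pos i)]; linarith [hs_lt i]
    | inr j => simp only [hxs, Sum.elim_inr]; exact hθR j
  have hy : ∀ x, ‖xl x‖ ≤ R := by
    intro x; cases x with
    | inl i => simp only [hxl, Sum.elim_inl, Complex.norm_real, Real.norm_eq_abs]
               rw [abs_of_pos (hℓ_pos i)]; linarith [hℓ_lt i]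
    | inr j => simp only [hxl, Sum.elim_inr]; exact hθR j
  have hxy : ∀ x, ‖xs x - xl x‖ ≤ δ := by
    intro x; cases x with
    | inl i => simp only [hxs, hxl, Sum.elim_inl]
               rw [← Complex.ofReal_sub, Complex.norm_real, Real.norm_eq_abs]; exact hdiff i
    | inr j => simp only [hxs, hxl, Sum.elim_inr, sub_self, norm_zero]; exact hδ0
  have hLip := norm_aeval_sub_aeval_le P hR1 hδ0 hx hy hxy (le_refl d)
  rw [hval0, sub_zero] at hLip
  -- (h) combine: `1 ≤ C · (2^d D L)^τ · D · (L d R^d δ)` and `D^{τ+1} = G^{N!}`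
  have hDpow : D ^ (τ + 1) = (G : ℝ) ^ N ! := by
    have eG : ((G : ℕ) : ℝ) ^ N ! = ∏ i, ((Bq i : ℝ) ^ d) ^ (τ + 1) := by
      rw [hG, hW]
      push_cast
      rw [← pow_mul, ← Finset.prod_pow]
      refine Finset.prod_congr rfl fun i _ => ?_
      rw [hBq]
      push_cast
      ring
    rw [eG, hD, ← Finset.prod_pow]
  have hchain : (1 : ℝ) ≤ A₀ * (G : ℝ) ^ N ! / 2 ^ (N + 1)! := by
    have h1 : (1 : ℝ) ≤ C * (2 ^ d * D * L) ^ τ * (D * (L * (d * R ^ d * δ))) := by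
      calc (1 : ℝ) ≤ C * (mvlen H : ℝ) ^ τ * (D * ‖MvPolynomial.aeval xs P‖) := hM
        _ ≤ C * (2 ^ d * D * L) ^ τ * (D * ‖MvPolynomial.aeval xs P‖) := by
            gcongr
        _ ≤ C * (2 ^ d * D * L) ^ τ * (D * (L * (d * R ^ d * δ))) := by
            gcongr
    have h2 : C * (2 ^ d * D * L) ^ τ * (D * (L * (d * R ^ d * δ))) =
        A₀ * D ^ (τ + 1) / 2 ^ (N + 1)! := by
      rw [hA₀, hδ]; ring
    rw [h2, hDpow] at h1
    exact h1
  have hlt := growth_beats (A₀ := A₀) hNG hNA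
  have hpos : (0 : ℝ) < 2 ^ (N + 1)! := by positivity
  rw [le_div_iff₀ hpos, one_mul] at hchain
  linarith

end Engine

end Summit.Schanuel.Schanuel.Theorems.RootDecomp1KCommonRadixCell

end
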